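import Literature.NumberTheory.Transcendental.GammaMonomials
import Literature.NumberTheory.Transcendental.GammaMonomialsDistribution
import Literature.Analysis.SpecialFunctions.GammaMultiplication
import Mathlib.RingTheory.Algebraic.Integral
import Mathlib.Analysis.SpecialFunctions.Pow.Real
import HarnessLib

/-!
# Algebraicity of Γ-monomials of Hodge type (Koblitz–Ogus): the discharge

Proof file (everything PROVED; no named facts, no definitions, no notation, no `sorry`) for the
named fact `Literature.NumberTheory.Transcendental.deligne_gammaMonomial_algebraic` of
`GammaMonomials.lean` (Deligne, *Hodge cycles on abelian varieties*, LNM 900, §7, Thm. 7.15 (a) /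
Thm. 7.18 (a), first clause): if `d > 1` and the multiplicities `n` on `{1/d, …, (d-1)/d}` satisfy
the Hodge-type condition `∑ n_i {u i/d} = c` for all `u` coprime to `d`, then
`Γ̃(𝐛) = (2πi)^{-c} ∏ Γ(i/d)^{n_i}` is an algebraic number. The theorem proved here is
`deligne_gammaMonomial_algebraic_holds`.

Deligne's proof (absolute Hodge cycles on Fermat hypersurfaces) is out of reach; we formalise the
**elementary proof of Koblitz and Ogus** (appendix to Deligne, *Valeurs de fonctions L et périodes
d'intégrales*, PSPM 33.2 (1979), 343–346; announced in LNM 900, Rem. 7.16 (a)): "by taking the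
correct combinations of multiplication and reflection formulae", the combinations being supplied by
the Kubert–Lang theory of distributions. Architecture (three files):

1. `GammaMonomialsLValue` — the arithmetic input `B_{1,χ} ≠ 0` for odd primitive `χ`
   (`L(0, χ) = -B_{1,χ}` via `hurwitzZetaOdd a 0 = 1/2 - a`, and `L(0, χ) ≠ 0` from Mathlib's
   functional equation and `L(1, χ̄) ≠ 0`).
2. `GammaMonomialsDistribution` — on `ℤ/N`: the Bernoulli distribution `β` and its unit twists
   are odd distributions; every odd distribution is a combination of them (Kubert–Lang; character
   coordinates, conductor theory, orthogonality); hence (double annihilator) a function of Hodge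
   type `f` (i.e. `f ⊥ β(u·)` for all units `u`) has a positive multiple `n₀ f` which is an
   INTEGRAL combination of reflection vectors `e_a + e_{-a}` and distribution vectors
   `∑_{x ≡ y (M)} e_x - e_{(N/M) y}` (`M ∣ N`) — `KoblitzOgus.hodge_eq_combination_int`.
3. This file — (i) `hodge_condition_zmod`: the printed Hodge-type condition, re-indexed by
   `x ∈ ℤ/d` (`f(x) = n_{x.val}`, `f(0) = 0`), says `∑_x f(x) β(ux) = 0` for all units `u` and
   `∑_x f(x) = 2c` (compare `u` and `-u`); (ii) the Γ-monomial of a reflection vector is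
   `Γ(⟨a⟩)Γ(⟨-a⟩) = π / sin(πa/d)` (`weight_refl`, Euler's reflection formula
   `Real.Gamma_mul_Gamma_one_sub`; `sin(πa/d)` is algebraic as `e^{iπa/d}` is a root of unity),
   that of a distribution vector is `√m (2π)^{(m-1)/2} m^{-⟨·⟩}`, `m = d/M` (`weight_dist`, Gauss's
   multiplication formula `Literature.Analysis.SpecialFunctions.GaussMultiplication.real_formula`,
   proved in the tree); in both cases "algebraic × `√π`^(mass of the vector off `0`)";
   (iii) multiplying out along the relation of (2), `(∏_x Γ(⟨x⟩)^{f(x)})^{n₀} ∈ √π^{2 n₀ c} ℚ̄ =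
   π^{n₀ c} ℚ̄` (`sum_erase_refl`, `sum_erase_dist` count the masses), so
   `Γ̃(𝐛)^{n₀} ∈ (2i)^{-c n₀} ℚ̄` is algebraic, hence so is `Γ̃(𝐛)` (`IsAlgebraic.of_pow`).

References: [Deligne1982HodgeCycles] §7, Thm. 7.15, Rem. 7.16 (a), Thm. 7.18; [KoblitzOgus1979];
S. Lang, *Cyclotomic Fields I–II*, Ch. 2 [Lang1990].
-/

noncomputable section

open Finset

namespace Literature.NumberTheory.Transcendental

namespace KoblitzOgus

/-! ### Bookkeeping: "algebraic times a power of `√π`" -/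

/-- Closure of `∃ a algebraic, t = a · √π^k` under products. [folklore] -/
theorem weight_mul {t₁ t₂ : ℝ} {k₁ k₂ : ℤ}
    (h₁ : ∃ a : ℝ, IsAlgebraic ℚ a ∧ t₁ = a * Real.sqrt Real.pi ^ k₁)
    (h₂ : ∃ a : ℝ, IsAlgebraic ℚ a ∧ t₂ = a * Real.sqrt Real.pi ^ k₂) :
    ∃ a : ℝ, IsAlgebraic ℚ a ∧ t₁ * t₂ = a * Real.sqrt Real.pi ^ (k₁ + k₂) := by
  obtain ⟨a₁, ha₁, rfl⟩ := h₁
  obtain ⟨a₂, ha₂, rfl⟩ := h₂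
  refine ⟨a₁ * a₂, ha₁.mul ha₂, ?_⟩
  have hS : Real.sqrt Real.pi ≠ 0 := (Real.sqrt_pos.mpr Real.pi_pos).ne'
  rw [zpow_add₀ hS]
  ring

/-- Closure under integer powers. [folklore] -/
theorem weight_zpow {t : ℝ} {k : ℤ} (h : ∃ a : ℝ, IsAlgebraic ℚ a ∧ t = a * Real.sqrt Real.pi ^ k)
    (m : ℤ) : ∃ a : ℝ, IsAlgebraic ℚ a ∧ t ^ m = a * Real.sqrt Real.pi ^ (m * k) := by
  obtain ⟨a, ha, rfl⟩ := h
  refine ⟨a ^ m, ?_, ?_⟩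
  · rcases Int.eq_nat_or_neg m with ⟨j, rfl | rfl⟩
    · rw [zpow_natCast]; exact ha.pow j
    · rw [zpow_neg, zpow_natCast]; exact (ha.pow j).inv
  · rw [mul_zpow, mul_comm m k, zpow_mul]

/-- Closure under finite products. [folklore] -/
theorem weight_prod {ι : Type*} (s : Finset ι) (t : ι → ℝ) (k : ι → ℤ)
    (h : ∀ i ∈ s, ∃ a : ℝ, IsAlgebraic ℚ a ∧ t i = a * Real.sqrt Real.pi ^ k i) :
    ∃ a : ℝ, IsAlgebraic ℚ a ∧ ∏ i ∈ s, t i = a * Real.sqrt Real.pi ^ (∑ i ∈ s, k i) := by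
  classical
  induction s using Finset.induction_on with
  | empty => exact ⟨1, isAlgebraic_one, by simp⟩
  | insert i s hi ih =>
    rw [prod_insert hi, sum_insert hi]
    exact weight_mul (h i (mem_insert_self i s)) (ih fun j hj => h j (mem_insert_of_mem hj))

/-- An algebraic number has weight `0`. [folklore] -/
theorem weight_of_isAlgebraic {t : ℝ} (h : IsAlgebraic ℚ t) :
    ∃ a : ℝ, IsAlgebraic ℚ a ∧ t = a * Real.sqrt Real.pi ^ (0 : ℤ) := ⟨t, h, by simp⟩

/-- `x ^ (∑ e) = ∏ x ^ e` for integer exponents and `x ≠ 0`. [folklore] -/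
theorem zpow_finset_sum {ι : Type*} (s : Finset ι) {x : ℝ} (hx : x ≠ 0) (e : ι → ℤ) :
    x ^ (∑ i ∈ s, e i) = ∏ i ∈ s, x ^ e i := by
  classical
  induction s using Finset.induction_on with
  | empty => simp
  | insert i s hi ih => rw [sum_insert hi, prod_insert hi, zpow_add₀ hx, ih]

/-! ### Some algebraic numbers -/

/-- Real numbers that are algebraic as complex numbers are algebraic. [folklore] -/
theorem isAlgebraic_of_ofReal {x : ℝ} (h : IsAlgebraic ℚ (x : ℂ)) : IsAlgebraic ℚ x :=
  (isAlgebraic_algebraMap_iff (R := ℚ) (S := ℝ) (A := ℂ) Complex.ofReal_injective).mp h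

/-- `e^{iθ}` with `θ = πa/b` is a root of unity, hence algebraic. [folklore] -/
theorem isAlgebraic_exp_rat_mul_pi (a : ℕ) {b : ℕ} (hb : 0 < b) :
    IsAlgebraic ℚ (Complex.exp ((Real.pi * a / b : ℝ) * Complex.I)) := by
  refine IsAlgebraic.of_pow (Nat.mul_pos two_pos hb) ?_
  rw [← Complex.exp_nat_mul]
  have : ((2 * b : ℕ) : ℂ) * (((Real.pi * a / b : ℝ) : ℂ) * Complex.I) = a * (2 * Real.pi * Complex.I) := by
    have hb' : (b : ℂ) ≠ 0 := by exact_mod_cast hb.ne'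
    push_cast
    field_simp
  rw [this, Complex.exp_nat_mul_two_pi_mul_I]
  exact isAlgebraic_one

/-- `i` is algebraic. [folklore] -/
theorem isAlgebraic_I : IsAlgebraic ℚ Complex.I := by
  refine IsAlgebraic.of_pow two_pos ?_
  rw [Complex.I_sq]
  exact isAlgebraic_one.neg

/-- `cos(πa/b)` is algebraic. [folklore] -/
theorem isAlgebraic_cos_rat_mul_pi (a : ℕ) {b : ℕ} (hb : 0 < b) :
    IsAlgebraic ℚ (Real.cos (Real.pi * a / b)) := by
  apply isAlgebraic_of_ofReal
  have h := isAlgebraic_exp_rat_mul_pi a hb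
  have h' : IsAlgebraic ℚ (Complex.exp (-(((Real.pi * a / b : ℝ) : ℂ) * Complex.I))) := by
    rw [Complex.exp_neg]; exact h.inv
  have : ((Real.cos (Real.pi * a / b) : ℝ) : ℂ) =
      (Complex.exp (((Real.pi * a / b : ℝ) : ℂ) * Complex.I) +
        Complex.exp (-(((Real.pi * a / b : ℝ) : ℂ) * Complex.I))) / 2 := by
    rw [Complex.ofReal_cos, Complex.cos, neg_mul]
  rw [this, div_eq_mul_inv]
  exact (h.add h').mul (isAlgebraic_nat 2).inv

/-- `sin(πa/b)` is algebraic. [folklore] -/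
theorem isAlgebraic_sin_rat_mul_pi (a : ℕ) {b : ℕ} (hb : 0 < b) :
    IsAlgebraic ℚ (Real.sin (Real.pi * a / b)) := by
  apply isAlgebraic_of_ofReal
  have h := isAlgebraic_exp_rat_mul_pi a hb
  have h' : IsAlgebraic ℚ (Complex.exp (-(((Real.pi * a / b : ℝ) : ℂ) * Complex.I))) := by
    rw [Complex.exp_neg]; exact h.inv
  have : ((Real.sin (Real.pi * a / b) : ℝ) : ℂ) =
      (Complex.exp (-(((Real.pi * a / b : ℝ) : ℂ) * Complex.I)) -
        Complex.exp (((Real.pi * a / b : ℝ) : ℂ) * Complex.I)) * Complex.I / 2 := by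
    rw [Complex.ofReal_sin, Complex.sin, neg_mul]
  rw [this, div_eq_mul_inv]
  exact ((h'.sub h).mul isAlgebraic_I).mul (isAlgebraic_nat 2).inv

/-- A rational power of a natural number is algebraic: `m^{p/q}`. [folklore] -/
theorem isAlgebraic_nat_rpow_rat {m : ℕ} (hm : 0 < m) (p : ℤ) {q : ℕ} (hq : 0 < q) :
    IsAlgebraic ℚ ((m : ℝ) ^ ((p : ℝ) / q)) := by
  refine IsAlgebraic.of_pow hq ?_
  have hm' : (0 : ℝ) ≤ m := by positivity
  rw [← Real.rpow_natCast, ← Real.rpow_mul hm', div_mul_cancel₀ _ (by exact_mod_cast hq.ne'),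
    Real.rpow_intCast]
  rcases Int.eq_nat_or_neg p with ⟨j, rfl | rfl⟩
  · rw [zpow_natCast]; exact (isAlgebraic_nat m).pow j
  · rw [zpow_neg, zpow_natCast]; exact ((isAlgebraic_nat m).pow j).inv

/-- `√π^(n) = π^{n/2}` as a real power (`n : ℕ`). [folklore] -/
theorem sqrt_pi_pow (n : ℕ) : Real.sqrt Real.pi ^ (n : ℤ) = Real.pi ^ (((n : ℝ)) / 2) := by
  rw [zpow_natCast, Real.sqrt_eq_rpow, ← Real.rpow_mul_natCast Real.pi_pos.le]
  congr 1
  ring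

/-! ### The `Γ`-values `Γ(⟨x/d⟩)` on `ℤ/d` and the weights of the two kinds of relations

No definitions are introduced: the `Γ`-value attached to `x ∈ ℤ/d` is always written
`Real.Gamma (if x = 0 then 1 else x.val / d)` (Deligne's representative `⟨x⟩ ∈ (0, 1]`, so that
`⟨0⟩ = 1` and `Γ(⟨0⟩) = 1`), the fibre of reduction mod `M` through `y` is the `Finset.filter` of
`x.val % M = y.val % M`, and the Bernoulli distribution is the `if … then 0 else x.val/d - 1/2` of
`GammaMonomialsDistribution`. -/

section Gamma

variable {d : ℕ} [NeZero d]


/-- `Γ(⟨x/d⟩) > 0`. [folklore] -/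
theorem gam_pos (x : ZMod d) : 0 < (Real.Gamma (if x = (0 : ZMod d) then (1 : ℝ) else ((ZMod.val x : ℝ) / (d : ℝ)))) := by
  apply Real.Gamma_pos_of_pos
  split_ifs with h
  · exact one_pos
  · exact div_pos (by exact_mod_cast Nat.pos_of_ne_zero ((ZMod.val_ne_zero x).mpr h))
      (by exact_mod_cast NeZero.pos d)

/-- **Reflection weight**: `Γ(⟨a/d⟩) Γ(⟨-a/d⟩) = π / sin(πa/d)` for `a ≠ 0` (and `= 1` for `a = 0`)
is an algebraic number times `√π^2` (resp. `√π^0`). [folklore] -/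
theorem weight_refl (a : ZMod d) :
    ∃ α : ℝ, IsAlgebraic ℚ α ∧ (Real.Gamma (if a = (0 : ZMod d) then (1 : ℝ) else ((ZMod.val a : ℝ) / (d : ℝ)))) * (Real.Gamma (if (-a) = (0 : ZMod d) then (1 : ℝ) else ((ZMod.val (-a) : ℝ) / (d : ℝ)))) =
      α * Real.sqrt Real.pi ^ (if a = 0 then (0 : ℤ) else 2) := by
  by_cases ha : a = 0
  · refine ⟨1, isAlgebraic_one, ?_⟩
    simp [ha, Real.Gamma_one]
  · have hna : -a ≠ 0 := neg_ne_zero.mpr ha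
    have hd : (0 : ℝ) < d := by exact_mod_cast NeZero.pos d
    have hv : (ZMod.val (-a) : ℝ) / d = 1 - (ZMod.val a : ℝ) / d := by
      rw [ZMod.neg_val, if_neg ha, Nat.cast_sub (ZMod.val_lt a).le]
      field_simp
    rw [if_neg ha, if_neg hna, if_neg ha, hv, Real.Gamma_mul_Gamma_one_sub]
    refine ⟨(Real.sin (Real.pi * ((ZMod.val a : ℝ) / d)))⁻¹, ?_, ?_⟩
    · rw [← mul_div_assoc]
      exact (isAlgebraic_sin_rat_mul_pi (ZMod.val a) (NeZero.pos d)).inv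
    · rw [show ((2 : ℤ)) = ((2 : ℕ) : ℤ) from rfl, zpow_natCast, Real.sq_sqrt Real.pi_pos.le]
      ring

/-- The product over a fibre of reduction mod `M` as a product over `j < d/M`. [folklore] -/
theorem prod_fiber_eq_prod_range {M : ℕ} (hM : M ∣ d) (y : ZMod d) :
    ∏ x ∈ (Finset.univ.filter (fun x' : ZMod d => ZMod.val x' % M = ZMod.val y % M)), (Real.Gamma (if x = (0 : ZMod d) then (1 : ℝ) else ((ZMod.val x : ℝ) / (d : ℝ)))) = ∏ j ∈ range (d / M), (Real.Gamma (if (((y.val % M + j * M : ℕ) : ZMod d)) = (0 : ZMod d) then (1 : ℝ) else ((ZMod.val (((y.val % M + j * M : ℕ) : ZMod d)) : ℝ) / (d : ℝ)))) := by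
  have hlog := sum_fiber_eq_sum_range hM y (fun x => Real.log ((Real.Gamma (if x = (0 : ZMod d) then (1 : ℝ) else ((ZMod.val x : ℝ) / (d : ℝ))))))
  have h1 : Real.log (∏ x ∈ (Finset.univ.filter (fun x' : ZMod d => ZMod.val x' % M = ZMod.val y % M)), (Real.Gamma (if x = (0 : ZMod d) then (1 : ℝ) else ((ZMod.val x : ℝ) / (d : ℝ))))) =
      Real.log (∏ j ∈ range (d / M), (Real.Gamma (if (((y.val % M + j * M : ℕ) : ZMod d)) = (0 : ZMod d) then (1 : ℝ) else ((ZMod.val (((y.val % M + j * M : ℕ) : ZMod d)) : ℝ) / (d : ℝ))))) := by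
    rw [Real.log_prod (fun x _ => (gam_pos x).ne'), Real.log_prod (fun j _ => (gam_pos _).ne'), hlog]
  exact Real.log_injOn_pos (Set.mem_Ioi.mpr (prod_pos fun x _ => gam_pos x))
    (Set.mem_Ioi.mpr (prod_pos fun j _ => gam_pos _)) h1

/-- **Distribution weight (Gauss multiplication).** For `M ∣ d`, `m = d/M` and `y ∈ ℤ/d`:
`(∏_{x ≡ y (mod M)} Γ(⟨x/d⟩)) / Γ(⟨(d/M)y / d⟩) = √m (2π)^{(m-1)/2} m^{-⟨y/M⟩'}` is an algebraic
number times `√π^{m-1}`; this is Gauss's multiplication formula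
`∏_{j<m} Γ(x + j/m) = Γ(mx) √m (2π)^{(m-1)/2} m^{-mx}`
(`Literature.Analysis.SpecialFunctions.GaussMultiplication.real_formula`) at `x = r/d`,
`r = y mod M` (and at `x = 1/m` when `r = 0`, where the fibre contains `0`, `Γ(⟨0⟩) = Γ(1)`).
[cite: KoblitzOgus1979, p. 344] -/
theorem weight_dist {M : ℕ} (hM : M ∣ d) (y : ZMod d) :
    ∃ α : ℝ, IsAlgebraic ℚ α ∧
      (∏ x ∈ (Finset.univ.filter (fun x' : ZMod d => ZMod.val x' % M = ZMod.val y % M)), (Real.Gamma (if x = (0 : ZMod d) then (1 : ℝ) else ((ZMod.val x : ℝ) / (d : ℝ))))) * ((Real.Gamma (if (((d / M : ℕ) : ZMod d) * y) = (0 : ZMod d) then (1 : ℝ) else ((ZMod.val (((d / M : ℕ) : ZMod d) * y) : ℝ) / (d : ℝ)))))⁻¹ =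
        α * Real.sqrt Real.pi ^ (((d / M : ℕ) : ℤ) - 1) := by
  obtain ⟨hM0, hm0, hdM⟩ := div_ne_zero_of_dvd hM
  have hd : (0 : ℝ) < d := by exact_mod_cast NeZero.pos d
  have hMr : (0 : ℝ) < M := by exact_mod_cast Nat.pos_of_ne_zero hM0
  set m := d / M with hmdef
  have hmr : (0 : ℝ) < m := by exact_mod_cast Nat.pos_of_ne_zero hm0
  have h1m : 1 ≤ m := Nat.pos_of_ne_zero hm0
  have hdMr : (d : ℝ) = M * m := by exact_mod_cast hdM
  set r := y.val % M with hrdef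
  have hrM : r < M := Nat.mod_lt _ (Nat.pos_of_ne_zero hM0)
  -- values on the fibre
  have hxval : ∀ j ∈ range m, ((r + j * M : ℕ) : ZMod d).val = r + j * M := fun j hj =>
    ZMod.val_natCast_of_lt (mod_add_mul_lt hM y (mem_range.mp hj))
  -- the base point of the multiplication formula
  set x₀ : ℝ := if r = 0 then 1 / m else (r : ℝ) / d with hx₀def
  have hx₀ : 0 < x₀ := by
    rw [hx₀def]; split_ifs with h
    · positivity
    · exact div_pos (by exact_mod_cast Nat.pos_of_ne_zero h) hd
  have hmx₀ : (m : ℝ) * x₀ = if r = 0 then 1 else (r : ℝ) / M := by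
    rw [hx₀def]; split_ifs with h
    · field_simp
    · rw [hdMr]; field_simp
  -- the fibre product is `prodGamma m x₀`
  have hpg : ∏ x ∈ (Finset.univ.filter (fun x' : ZMod d => ZMod.val x' % M = ZMod.val y % M)), (Real.Gamma (if x = (0 : ZMod d) then (1 : ℝ) else ((ZMod.val x : ℝ) / (d : ℝ)))) =
      Literature.Analysis.SpecialFunctions.GaussMultiplication.prodGamma m x₀ := by
    rw [prod_fiber_eq_prod_range hM y]
    unfold Literature.Analysis.SpecialFunctions.GaussMultiplication.prodGamma
    by_cases hr0 : r = 0
    · -- the fibre through `0`: shift the index by one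
      obtain ⟨m', hm'⟩ := Nat.exists_eq_succ_of_ne_zero hm0
      rw [← hmdef, hx₀def, if_pos hr0, hm']
      conv_lhs => rw [prod_range_succ']
      conv_rhs => rw [prod_range_succ]
      congr 1
      · refine prod_congr rfl fun j hj => ?_
        have hj' : j + 1 ∈ range m := by rw [hm']; exact mem_range.mpr (by linarith [mem_range.mp hj])
        have hne : ((r + (j + 1) * M : ℕ) : ZMod d) ≠ 0 := by
          rw [Ne, ← ZMod.val_eq_zero, hxval _ hj']
          positivity
        rw [if_neg hne, hxval _ hj', hr0, zero_add]
        congr 1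
        push_cast
        rw [hdMr, hm']
        push_cast
        field_simp
        ring
      · have h0 : ((r + 0 * M : ℕ) : ZMod d) = 0 := by rw [hr0]; simp
        rw [if_pos h0]
        congr 1
        rw [Nat.cast_succ, ← add_div, add_comm, div_self (by positivity : ((m' : ℝ) + 1) ≠ 0)]
    · rw [hx₀def, if_neg hr0]
      refine prod_congr rfl fun j hj => ?_
      have hne : ((r + j * M : ℕ) : ZMod d) ≠ 0 := by
        rw [Ne, ← ZMod.val_eq_zero, hxval _ hj]
        omega
      rw [if_neg hne, hxval _ hj]
      push_cast
      rw [hdMr]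
      field_simp
  -- the value at `(d/M)·y`
  have hval : (((d / M : ℕ) : ZMod d) * y).val = m * r := val_div_mul hM y
  have htarget : (Real.Gamma (if (((d / M : ℕ) : ZMod d) * y) = (0 : ZMod d) then (1 : ℝ) else ((ZMod.val (((d / M : ℕ) : ZMod d) * y) : ℝ) / (d : ℝ)))) = Real.Gamma (m * x₀) := by
    rw [hmx₀]
    by_cases hr0 : r = 0
    · have hz : ((d / M : ℕ) : ZMod d) * y = 0 := by rw [← ZMod.val_eq_zero, hval, hr0, mul_zero]
      rw [if_pos hz, if_pos hr0]
    · have hz : ((d / M : ℕ) : ZMod d) * y ≠ 0 := by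
        rw [Ne, ← ZMod.val_eq_zero, hval]; exact Nat.mul_ne_zero hm0 hr0
      rw [if_neg hz, if_neg hr0, hval]
      congr 1
      push_cast
      rw [hdMr]
      field_simp
  -- Gauss multiplication
  have hrf := Literature.Analysis.SpecialFunctions.GaussMultiplication.real_formula hm0 hx₀
  have hG : Real.Gamma (m * x₀) ≠ 0 := (Real.Gamma_pos_of_pos (by positivity)).ne'
  have hmpow : (m : ℝ) ^ ((m : ℝ) * x₀) ≠ 0 := (Real.rpow_pos_of_pos hmr _).ne'
  refine ⟨Real.sqrt m * (2 : ℝ) ^ (((m : ℝ) - 1) / 2) * ((m : ℝ) ^ ((m : ℝ) * x₀))⁻¹, ?_, ?_⟩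
  · -- algebraicity of the constant
    refine IsAlgebraic.mul (IsAlgebraic.mul ?_ ?_) (IsAlgebraic.inv ?_)
    · rw [Real.sqrt_eq_rpow]
      have := isAlgebraic_nat_rpow_rat (Nat.pos_of_ne_zero hm0) 1 two_pos
      norm_num at this
      exact this
    · have := isAlgebraic_nat_rpow_rat two_pos ((m : ℤ) - 1) two_pos
      push_cast at this
      exact this
    · rw [hmx₀]
      split_ifs with h
      · rw [Real.rpow_one]; exact isAlgebraic_nat m
      · have := isAlgebraic_nat_rpow_rat (Nat.pos_of_ne_zero hm0) (r : ℤ) (Nat.pos_of_ne_zero hM0)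
        push_cast at this
        exact this
  · -- the identity
    rw [hpg, htarget]
    have hsq : Real.sqrt Real.pi ^ (((d / M : ℕ) : ℤ) - 1) = Real.pi ^ (((m : ℝ) - 1) / 2) := by
      rw [show (((d / M : ℕ) : ℤ) - 1) = ((m - 1 : ℕ) : ℤ) by rw [← hmdef]; push_cast [Nat.cast_sub h1m]; ring,
        sqrt_pi_pow, Nat.cast_sub h1m, Nat.cast_one]
    rw [hsq]
    have h2pi : (2 * Real.pi) ^ (((m : ℝ) - 1) / 2) = (2 : ℝ) ^ (((m : ℝ) - 1) / 2) * Real.pi ^ (((m : ℝ) - 1) / 2) :=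
      Real.mul_rpow (by norm_num) Real.pi_pos.le
    rw [h2pi] at hrf
    field_simp
    linear_combination hrf

end Gamma

/-! ### Reindexing `Ico 1 d ↔ ℤ/d ∖ {0}`, indicator products, and two counting lemmas -/

section Counting

variable {d : ℕ} [NeZero d]


/-- `∏_{i=1}^{d-1} G(i) = ∏_{x ∈ ℤ/d, x ≠ 0} G(x.val)`. [folklore] -/
theorem prod_Ico_eq_prod_erase {α : Type*} [CommMonoid α] (G : ℕ → α) :
    ∏ i ∈ Ico 1 d, G i = ∏ x ∈ (univ : Finset (ZMod d)).erase 0, G x.val := by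
  symm
  refine prod_nbij' (fun x : ZMod d => x.val) (fun i : ℕ => (i : ZMod d)) ?_ ?_ ?_ ?_ ?_
  · intro x hx
    have hx0 : x ≠ 0 := (mem_erase.mp hx).1
    exact mem_Ico.mpr ⟨Nat.pos_of_ne_zero ((ZMod.val_ne_zero x).mpr hx0), ZMod.val_lt x⟩
  · intro i hi
    obtain ⟨h1, h2⟩ := mem_Ico.mp hi
    refine mem_erase.mpr ⟨?_, mem_univ _⟩
    rw [Ne, ← ZMod.val_eq_zero, ZMod.val_natCast_of_lt h2]
    omega
  · intro x _
    exact ZMod.natCast_zmod_val x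
  · intro i hi
    exact ZMod.val_natCast_of_lt (mem_Ico.mp hi).2
  · intro x _
    rfl

/-- Additive version of `prod_Ico_eq_prod_erase`. [folklore] -/
theorem sum_Ico_eq_sum_erase {α : Type*} [AddCommMonoid α] (G : ℕ → α) :
    ∑ i ∈ Ico 1 d, G i = ∑ x ∈ (univ : Finset (ZMod d)).erase 0, G x.val :=
  @prod_Ico_eq_prod_erase d _ (Multiplicative α) _ G

/-- `∏_x t(x)^{[p = x]} = t(p)`. [folklore] -/
theorem prod_zpow_ite_eq (t : ZMod d → ℝ) (p : ZMod d) :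
    ∏ x : ZMod d, t x ^ (if p = x then (1 : ℤ) else 0) = t p := by
  have : ∀ x : ZMod d, t x ^ (if p = x then (1 : ℤ) else 0) = if p = x then t x else 1 := by
    intro x; split_ifs <;> simp
  rw [prod_congr rfl fun x _ => this x, prod_ite_eq]
  simp

/-- `∏_x t(x)^{[x ∈ s]} = ∏_{x ∈ s} t(x)` for a fibre `s`. [folklore] -/
theorem prod_zpow_ite_mem (t : ZMod d → ℝ) (M : ℕ) (y : ZMod d) :
    ∏ x : ZMod d, t x ^ (if x.val % M = y.val % M then (1 : ℤ) else 0) = ∏ x ∈ (Finset.univ.filter (fun x' : ZMod d => ZMod.val x' % M = ZMod.val y % M)), t x := by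
  rw [prod_filter]
  refine prod_congr rfl fun x _ => ?_
  split_ifs <;> simp

/-- Reduced mass of a reflection vector: `∑_{x ≠ 0} ([a = x] + [-a = x]) = 2·[a ≠ 0]`. [folklore] -/
theorem sum_erase_refl (a : ZMod d) :
    ∑ x ∈ (univ : Finset (ZMod d)).erase 0, ((if a = x then (1 : ℤ) else 0) + (if -a = x then 1 else 0)) =
      if a = 0 then 0 else 2 := by
  rw [sum_add_distrib, sum_ite_eq, sum_ite_eq]
  simp only [mem_erase, ne_eq, mem_univ, and_true, neg_eq_zero]
  split_ifs <;> simp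

/-- The cardinality of a fibre of reduction mod `M ∣ d` is `d/M`. [folklore] -/
theorem card_fib {M : ℕ} (hM : M ∣ d) (y : ZMod d) : (#(Finset.univ.filter (fun x' : ZMod d => ZMod.val x' % M = ZMod.val y % M)) : ℤ) = (d / M : ℕ) := by
  have h := sum_fiber_eq_sum_range hM y (fun _ => (1 : ℤ))
  rw [sum_const, sum_const, card_range] at h
  simpa using h

/-- Reduced mass of a distribution vector: `∑_{x ≠ 0} ([x ≡ y (M)] - [(d/M)y = x]) = d/M - 1`.
[folklore] -/
theorem sum_erase_dist {M : ℕ} (hM : M ∣ d) (y : ZMod d) :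
    ∑ x ∈ (univ : Finset (ZMod d)).erase 0,
      ((if x.val % M = y.val % M then (1 : ℤ) else 0) - (if ((d / M : ℕ) : ZMod d) * y = x then 1 else 0)) =
      ((d / M : ℕ) : ℤ) - 1 := by
  obtain ⟨hM0, hm0, hdM⟩ := div_ne_zero_of_dvd hM
  rw [sum_erase_eq_sub (mem_univ _), sum_sub_distrib, sum_boole, sum_ite_eq, card_fib hM y]
  simp only [mem_univ, if_true, ZMod.val_zero, Nat.zero_mod]
  have hval : (((d / M : ℕ) : ZMod d) * y).val = d / M * (y.val % M) := val_div_mul hM y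
  by_cases hr : y.val % M = 0
  · have hz : ((d / M : ℕ) : ZMod d) * y = 0 := by rw [← ZMod.val_eq_zero, hval, hr, mul_zero]
    rw [if_pos hr.symm, if_pos hz]
    ring
  · have hz : ((d / M : ℕ) : ZMod d) * y ≠ 0 := by
      rw [Ne, ← ZMod.val_eq_zero, hval]; exact Nat.mul_ne_zero hm0 hr
    rw [if_neg (Ne.symm hr), if_neg hz]
    ring

end Counting

/-! ### The Hodge condition on `ℤ/d` -/

section Hodge

variable {d : ℕ} [NeZero d]


/-- **The Hodge-type condition in `ℤ/d`-form.** If `∑_{0<i<d} n_i {ui/d} = c` for all `u` coprime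
to `d`, then for `f(x) = n_{x.val}` (`f(0) = 0`): `∑_x f(x) β(ux) = 0` for every unit `u` of
`ℤ/d`, and `∑_x f(x) = 2c` (compare `u` with `-u`: `β` is odd). [cite: KoblitzOgus1979, p. 343] -/
theorem hodge_condition_zmod (n : ℕ → ℤ) (c : ℤ) (hH : IsHodgeTypeGammaMonomial d n c) :
    (∀ u : ZMod d, IsUnit u →
      ∑ x : ZMod d, ((if x = 0 then 0 else n x.val : ℤ) : ℚ) * (if (u * x) = (0 : ZMod d) then (0 : ℚ) else (((ZMod.val (u * x) : ℕ) : ℚ) / (d : ℚ) - 1 / 2)) = 0) ∧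
    ∑ x : ZMod d, ((if x = 0 then 0 else n x.val : ℤ) : ℚ) = 2 * c := by
  classical
  have hd : (d : ℚ) ≠ 0 := by exact_mod_cast NeZero.ne d
  -- the value `c - s/2` for every unit
  have key : ∀ u : ZMod d, IsUnit u →
      ∑ x : ZMod d, ((if x = 0 then 0 else n x.val : ℤ) : ℚ) * (if (u * x) = (0 : ZMod d) then (0 : ℚ) else (((ZMod.val (u * x) : ℕ) : ℚ) / (d : ℚ) - 1 / 2)) =
        c - (1 / 2) * ∑ x : ZMod d, ((if x = 0 then 0 else n x.val : ℤ) : ℚ) := by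
    intro u hu
    have hcop : Nat.Coprime u.val d := by
      have := ZMod.val_coe_unit_coprime hu.unit
      rwa [IsUnit.unit_spec] at this
    have hHu := hH u.val hcop
    -- rewrite the printed sum over `Ico 1 d` as a sum over `ℤ/d ∖ {0}`
    rw [sum_Ico_eq_sum_erase] at hHu
    have hterm : ∀ x ∈ (univ : Finset (ZMod d)).erase 0,
        (n x.val : ℚ) * Int.fract ((u.val : ℚ) * (x.val : ℕ) / d) =
          ((if x = 0 then 0 else n x.val : ℤ) : ℚ) * (((u * x).val : ℚ) / d) := by
      intro x hx
      have hx0 : x ≠ 0 := (mem_erase.mp hx).1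
      rw [if_neg hx0, show (u.val : ℚ) * (x.val : ℕ) = ((u.val * x.val : ℕ) : ℚ) by push_cast; ring,
        Int.fract_div_natCast_eq_div_natCast_mod, ← ZMod.val_mul]
    rw [sum_congr rfl hterm] at hHu
    -- the Bernoulli sum, term by term
    have hterm2 : ∀ x : ZMod d, ((if x = 0 then 0 else n x.val : ℤ) : ℚ) * (if (u * x) = (0 : ZMod d) then (0 : ℚ) else (((ZMod.val (u * x) : ℕ) : ℚ) / (d : ℚ) - 1 / 2)) =
        ((if x = 0 then 0 else n x.val : ℤ) : ℚ) * (((u * x).val : ℚ) / d) -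
          (1 / 2) * ((if x = 0 then 0 else n x.val : ℤ) : ℚ) := by
      intro x
      by_cases hx0 : x = 0
      · simp [hx0]
      · have hux : u * x ≠ 0 := fun h => hx0 (by simpa using hu.mul_left_cancel (h.trans (mul_zero u).symm))
        rw [if_neg hux]
        ring
    rw [sum_congr rfl fun x _ => hterm2 x, sum_sub_distrib, ← mul_sum, ← hHu,
      ← sum_erase_add _ _ (mem_univ (0 : ZMod d))]
    simp
  refine ⟨fun u hu => ?_, ?_⟩
  · -- compare `u` and `-u`
    have h1 := key u hu
    have h2 := key (-u) hu.neg
    have hodd : ∑ x : ZMod d, ((if x = 0 then 0 else n x.val : ℤ) : ℚ) * (if (-u * x) = (0 : ZMod d) then (0 : ℚ) else (((ZMod.val (-u * x) : ℕ) : ℚ) / (d : ℚ) - 1 / 2)) =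
        -∑ x : ZMod d, ((if x = 0 then 0 else n x.val : ℤ) : ℚ) * (if (u * x) = (0 : ZMod d) then (0 : ℚ) else (((ZMod.val (u * x) : ℕ) : ℚ) / (d : ℚ) - 1 / 2)) := by
      rw [← sum_neg_distrib]
      refine sum_congr rfl fun x _ => ?_
      rw [neg_mul, bern_neg, mul_neg]
    rw [hodd, h1] at h2
    linarith
  · have h1 := key 1 isUnit_one
    have h2 := key (-1) isUnit_one.neg
    have hodd : ∑ x : ZMod d, ((if x = 0 then 0 else n x.val : ℤ) : ℚ) * (if (-1 * x) = (0 : ZMod d) then (0 : ℚ) else (((ZMod.val (-1 * x) : ℕ) : ℚ) / (d : ℚ) - 1 / 2)) =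
        -∑ x : ZMod d, ((if x = 0 then 0 else n x.val : ℤ) : ℚ) * (if (1 * x) = (0 : ZMod d) then (0 : ℚ) else (((ZMod.val (1 * x) : ℕ) : ℚ) / (d : ℚ) - 1 / 2)) := by
      rw [← sum_neg_distrib]
      refine sum_congr rfl fun x _ => ?_
      rw [neg_mul, bern_neg, mul_neg]
    rw [hodd, h1] at h2
    linarith

end Hodge

/-- Closure of algebraicity under integer powers (in a field). [folklore] -/
theorem isAlgebraic_zpow {K : Type*} [Field K] [Algebra ℚ K] {x : K} (h : IsAlgebraic ℚ x) (m : ℤ) :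
    IsAlgebraic ℚ (x ^ m) := by
  rcases Int.eq_nat_or_neg m with ⟨j, rfl | rfl⟩
  · rw [zpow_natCast]; exact h.pow j
  · rw [zpow_neg, zpow_natCast]; exact (h.pow j).inv

end KoblitzOgus

open KoblitzOgus in
/-- **Discharge of `deligne_gammaMonomial_algebraic`: Γ-monomials of Hodge type are algebraic**
(Deligne, LNM 900, Thm. 7.15 (a) / 7.18 (a), first clause; elementary proof of Koblitz–Ogus,
appendix to Deligne, PSPM 33.2 (1979), 343–346, as announced in LNM 900, Rem. 7.16 (a)).

Proof (Koblitz–Ogus). Index the arguments by `x ∈ ℤ/d`, `⟨x⟩ = x.val/d` (`⟨0⟩ := 1`), and let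
`f(x) = n_{x.val}`. (1) `hodge_condition_zmod`: the Hodge-type condition says that `f` is
orthogonal to all unit twists `β(u·)` of the Bernoulli distribution and has total mass `2c`.
(2) `KoblitzOgus.hodge_eq_combination_int` (Kubert–Lang: the unit twists of `β` span the odd
distributions, by `B_{1,χ} ≠ 0` for odd `χ`, i.e. `L(0, χ) ≠ 0`, file `GammaMonomialsLValue`): a
positive multiple `n₀ f` is an integral combination of reflection vectors `e_a + e_{-a}` and
distribution vectors `∑_{x ≡ y (M)} e_x - e_{(N/M)y}`. (3) The Γ-monomial of a reflection vector
is `Γ(⟨a⟩)Γ(⟨-a⟩) = π/sin(πa/d) ∈ √π² · ℚ̄` (`weight_refl`, Euler's reflection formula), that of a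
distribution vector is `∈ √π^{d/M-1} · ℚ̄` (`weight_dist`, Gauss's multiplication formula); in both
cases the exponent of `√π` is the mass of the vector off `0`, so `(∏ Γ(⟨x⟩)^{f(x)})^{n₀} ∈
√π^{2 n₀ c} · ℚ̄ = π^{n₀ c} · ℚ̄`. (4) Hence `Γ̃(𝐛)^{n₀} = (2πi)^{-c n₀} (∏ Γ^{f})^{n₀} ∈ (2i)^{-cn₀} ℚ̄`
is algebraic, and so is `Γ̃(𝐛)`. [cite: Deligne1982HodgeCycles, Thm. 7.18 (a)]
[cite: KoblitzOgus1979, pp. 343–346] -/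
theorem deligne_gammaMonomial_algebraic_holds : deligne_gammaMonomial_algebraic := by
  classical
  intro d n c hd hH
  haveI : NeZero d := ⟨by omega⟩
  obtain ⟨hT, hmass⟩ := hodge_condition_zmod n c hH
  -- the multiplicity function and the `Γ`-values on `ℤ/d`
  set f : ZMod d → ℤ := fun x => if x = 0 then 0 else n x.val with hf
  have hf0 : f 0 = 0 := by simp [hf]
  set γ : ZMod d → ℝ := fun x =>
    Real.Gamma (if x = (0 : ZMod d) then (1 : ℝ) else ((ZMod.val x : ℝ) / (d : ℝ))) with hγ
  have hγx : ∀ x, γ x = Real.Gamma (if x = (0 : ZMod d) then (1 : ℝ) else ((ZMod.val x : ℝ) / (d : ℝ))) :=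
    fun x => rfl
  clear_value γ
  have hγpos : ∀ x, 0 < γ x := fun x => by rw [hγx]; exact gam_pos x
  have hγ0 : ∀ x, γ x ≠ 0 := fun x => (hγpos x).ne'
  -- Step 2: the integral relation
  obtain ⟨n₀, hn₀, mr, md, hrel⟩ := hodge_eq_combination_int (N := d) f hT
  -- Step 3: the weight of `(∏ Γ(⟨x⟩)^{f x})^{n₀}`
  set S : ℝ := Real.sqrt Real.pi with hS
  have hS0 : S ≠ 0 := (Real.sqrt_pos.mpr Real.pi_pos).ne'
  set K : ℤ := ∑ a : ZMod d, (mr a * (if a = 0 then (0 : ℤ) else 2)) +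
    ∑ M ∈ d.divisors, ∑ y : ZMod d, (md M y * (((d / M : ℕ) : ℤ) - 1)) with hKdef
  have hW : ∃ α : ℝ, IsAlgebraic ℚ α ∧ (∏ x : ZMod d, γ x ^ f x) ^ (n₀ : ℤ) = α * S ^ K := by
    -- expand the exponent `n₀ f x` along the relation
    have hx : ∀ x : ZMod d, (γ x ^ f x) ^ (n₀ : ℤ) =
        (∏ a : ZMod d, (γ x ^ ((if a = x then (1 : ℤ) else 0) + (if -a = x then 1 else 0))) ^ mr a) *
        ∏ M ∈ d.divisors, ∏ y : ZMod d, (γ x ^ ((if x.val % M = y.val % M then (1 : ℤ) else 0) -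
          (if ((d / M : ℕ) : ZMod d) * y = x then 1 else 0))) ^ md M y := by
      intro x
      rw [← zpow_mul, mul_comm, hrel x, zpow_add₀ (hγ0 x), zpow_finset_sum _ (hγ0 x),
        zpow_finset_sum _ (hγ0 x)]
      congr 1
      · refine prod_congr rfl fun a _ => ?_
        rw [mul_comm, zpow_mul]
      · refine prod_congr rfl fun M _ => ?_
        rw [zpow_finset_sum _ (hγ0 x)]
        refine prod_congr rfl fun y _ => ?_
        rw [mul_comm, zpow_mul]
    have hsplit : (∏ x : ZMod d, γ x ^ f x) ^ (n₀ : ℤ) =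
        (∏ a : ZMod d, (∏ x : ZMod d,
          γ x ^ ((if a = x then (1 : ℤ) else 0) + (if -a = x then 1 else 0))) ^ mr a) *
        ∏ M ∈ d.divisors, ∏ y : ZMod d, (∏ x : ZMod d,
          γ x ^ ((if x.val % M = y.val % M then (1 : ℤ) else 0) -
            (if ((d / M : ℕ) : ZMod d) * y = x then 1 else 0))) ^ md M y := by
      rw [← prod_zpow, prod_congr rfl fun x _ => hx x, prod_mul_distrib, prod_comm]
      conv_lhs => arg 2; rw [prod_comm]; arg 2; ext M; rw [prod_comm]
      simp_rw [prod_zpow]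
    rw [hsplit]
    refine weight_mul (weight_prod _ _ _ fun a _ => weight_zpow ?_ (mr a))
      (weight_prod _ _ _ fun M hM => weight_prod _ _ _ fun y _ => weight_zpow ?_ (md M y))
    · -- reflection vectors
      have : ∏ x : ZMod d, γ x ^ ((if a = x then (1 : ℤ) else 0) + (if -a = x then 1 else 0)) =
          γ a * γ (-a) := by
        simp_rw [zpow_add₀ (hγ0 _)]
        rw [prod_mul_distrib, prod_zpow_ite_eq, prod_zpow_ite_eq]
      rw [this, hγx, hγx]
      exact weight_refl a
    · -- distribution vectors
      have hMd : M ∣ d := (Nat.mem_divisors.mp hM).1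
      have : ∏ x : ZMod d, γ x ^ ((if x.val % M = y.val % M then (1 : ℤ) else 0) -
            (if ((d / M : ℕ) : ZMod d) * y = x then 1 else 0)) =
          (∏ x ∈ Finset.univ.filter (fun x' : ZMod d => ZMod.val x' % M = ZMod.val y % M), γ x) *
            (γ (((d / M : ℕ) : ZMod d) * y))⁻¹ := by
        simp_rw [zpow_sub₀ (hγ0 _)]
        rw [prod_div_distrib, prod_zpow_ite_mem, prod_zpow_ite_eq, div_eq_mul_inv]
      rw [this]
      simp only [hγx]
      exact weight_dist hMd y
  -- the total weight is `2 n₀ c`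
  have hK : K = 2 * ((n₀ : ℤ) * c) := by
    have h1 : ∑ x ∈ (univ : Finset (ZMod d)).erase 0, (n₀ : ℤ) * f x = K := by
      rw [sum_congr rfl fun x _ => hrel x, sum_add_distrib, sum_comm]
      conv_lhs => arg 2; rw [sum_comm]; arg 2; ext M; rw [sum_comm]
      simp_rw [← mul_sum, sum_erase_refl]
      rw [hKdef]
      congr 1
      refine sum_congr rfl fun M hM => sum_congr rfl fun y _ => ?_
      rw [sum_erase_dist (Nat.mem_divisors.mp hM).1 y]
    have h2 : ∑ x ∈ (univ : Finset (ZMod d)).erase 0, (n₀ : ℤ) * f x = n₀ * (2 * c) := by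
      rw [← mul_sum, sum_erase _ (by rw [hf0])]
      congr 1
      exact_mod_cast hmass
    rw [← h1, h2]
    ring
  have hSK : S ^ K = Real.pi ^ ((n₀ : ℤ) * c) := by
    rw [hK, zpow_mul, show S ^ (2 : ℤ) = Real.pi from by
      rw [show (2 : ℤ) = ((2 : ℕ) : ℤ) from rfl, zpow_natCast, hS, Real.sq_sqrt Real.pi_pos.le]]
  obtain ⟨α, hα, hGα⟩ := hW
  rw [hSK] at hGα
  -- Step 4: the complex number `Γ̃(𝐛)^{n₀}`
  have hprodC : ∏ i ∈ Ico 1 d, ((Real.Gamma ((i : ℝ) / d) : ℝ) : ℂ) ^ (n i) =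
      ((∏ x : ZMod d, γ x ^ f x : ℝ) : ℂ) := by
    rw [Complex.ofReal_prod]
    rw [← prod_erase (s := (univ : Finset (ZMod d))) (a := (0 : ZMod d))
      (f := fun x => ((γ x ^ f x : ℝ) : ℂ)) (by rw [hf0, zpow_zero, Complex.ofReal_one])]
    rw [prod_Ico_eq_prod_erase (fun i => ((Real.Gamma ((i : ℝ) / d) : ℝ) : ℂ) ^ n i)]
    refine prod_congr rfl fun x hx => ?_
    have hx0 : x ≠ 0 := (mem_erase.mp hx).1
    rw [Complex.ofReal_zpow, hγx, if_neg hx0, hf]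
    simp only [if_neg hx0]
  have hpow : (gammaTilde d n c) ^ n₀ = (2 * Complex.I) ^ (-((n₀ : ℤ) * c)) * (α : ℂ) := by
    unfold gammaTilde
    rw [hprodC, mul_pow, ← zpow_natCast ((2 * (Real.pi : ℂ) * Complex.I) ^ (-c)), ← zpow_mul,
      ← Complex.ofReal_pow, ← zpow_natCast (∏ x : ZMod d, γ x ^ f x), hGα, Complex.ofReal_mul,
      Complex.ofReal_zpow, show (2 * (Real.pi : ℂ) * Complex.I) = (2 * Complex.I) * Real.pi by ring,
      mul_zpow]
    have hpi : ((Real.pi : ℝ) : ℂ) ≠ 0 := by exact_mod_cast Real.pi_pos.ne'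
    rw [show -c * (n₀ : ℤ) = -((n₀ : ℤ) * c) by ring, zpow_neg _ ((n₀ : ℤ) * c), zpow_neg _ ((n₀ : ℤ) * c)]
    field_simp
  have halg : IsAlgebraic ℚ ((gammaTilde d n c) ^ n₀) := by
    rw [hpow]
    refine IsAlgebraic.mul (isAlgebraic_zpow ((isAlgebraic_nat 2).mul isAlgebraic_I) _) ?_
    exact hα.algebraMap
  exact IsAlgebraic.of_pow hn₀ halg


end Literature.NumberTheory.Transcendental
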